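import Mathlib
import HarnessLib
import Summits.ResolutionOfSingularities.ResolutionOfSingularities.Theorems.WildQuotientsWildQuotientResolutionEigenlineActionRestrict
import Summits.ResolutionOfSingularities.ResolutionOfSingularities.Theorems.WildQuotientsWildQuotientResolutionAbelianEigenline
import Summits.ResolutionOfSingularities.ResolutionOfSingularities.Theorems.WildQuotientsWildQuotientResolutionKSGoingDownLocalGlue
import Summits.ResolutionOfSingularities.ResolutionOfSingularities.Theorems.WildQuotientsWildQuotientResolutionKSGoingDownExceptionalStable
import Literature.AlgebraicGeometry.Resolution.QuadraticTransformsStructure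

/-!
# Kollár–Szabó going down: the equivariant quadratic transform in the shape `S[𝔪/t]_𝔫` with all ring-level data of the
# local step (crux `WildQuotients.WildQuotientResolution`, stub `stub_phaseZeroHighDim`)

Crux stmt-ResolutionOfSingularities-15640 (`WildQuotientResolution`), registered stub `stub_phaseZeroHighDim`; programme:
`KollarSzaboGoingDown_holds` via ✓`kollarSzaboGoingDown_of_localStepLE` and ✓`localStep_package_ofPrime`. This file chains hand 8-g0's
eigenline (✓`AbelianEigenline.exists_stable_tangentHyperplane`, `exists_unit_mul_sub_mem_of_not_mem`), hand 8-g1's adapted regular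
system of parameters and ★ equivariant quadratic transform (✓`EigenlineChart.exists_rsop_adapted_to_hyperplane`,
✓`exists_equivariant_quadraticTransform`, ✓`exists_restrict_ringAut`) and the tree's chart change
(✓`IsQuadraticTransform.eq_ofPrime`) into ONE ring-level statement in exactly the shape consumed by ✓`localStep_package_ofPrime`:

* `exists_quadraticTransform_localData` — for a regular local `S ⊆ K` which is not a field, with algebraically closed residue field,
  and an action `σ : I →* (K ≃+* K)` of an abelian group preserving `S` and residue-trivial on it, there are `t ∈ 𝔪_S ∖ 𝔪_S²`
  (`t ≠ 0`) and a prime `𝔫 ∋ t` of the chart `S[𝔪/t]` such that `R₁ = S[𝔪/t]_𝔫` (`LocalSubring.ofPrime`) is `σ`-STABLE,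
  `σ` is RESIDUE-TRIVIAL on `R₁`, `κ(R₁)` is ALGEBRAICALLY CLOSED, and the exceptional ideal `(t)R₁` is `σ`-STABLE.

[OURS · crux stmt-ResolutionOfSingularities-15640 · helper toward `stub_phaseZeroHighDim` (ring-level assembly; NOT a proof of the stub);
counted 0; AI-level work, weaker than expert review.] [folklore, after ReichsteinYoussin2000, Appendix]
-/

-- single-problem summit: the doubled namespace component `ResolutionOfSingularities` is forced
set_option linter.dupNamespace false

noncomputable section

open IsLocalRing Literature.AlgebraicGeometry.Resolution
open Summit.ResolutionOfSingularities.ResolutionOfSingularities.Theorems.WildQuotientResolution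

namespace Summit.ResolutionOfSingularities.ResolutionOfSingularities.Theorems.WildQuotientResolution.KSGoingDown

universe u

set_option maxHeartbeats 800000 in
/-- ★ **The equivariant quadratic transform `R₁ = S[𝔪/t]_𝔫` with all ring-level data of the local blow-up step.**
See the module docstring. [folklore, after ReichsteinYoussin2000, Appendix, proof of Prop. A.2] -/
theorem exists_quadraticTransform_localData {K : Type u} [Field K] (S : Subring K) [IsRegularLocalRing S]
    [IsAlgClosed (ResidueField S)] (hS : ¬ IsField S)
    {I : Type u} [CommGroup I] (σ : I →* (K ≃+* K)) (hσS : ∀ h : I, ∀ s ∈ S, σ h s ∈ S)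
    (hres : ∀ (h : I) (s : S), (⟨σ h s, hσS h s s.2⟩ : S) - s ∈ maximalIdeal S) :
    ∃ (t : K) (htS : t ∈ S) (_ : (⟨t, htS⟩ : S) ∈ maximalIdeal S) (_ : (⟨t, htS⟩ : S) ∉ maximalIdeal S ^ 2)
      (_ : t ≠ 0) (𝔫 : Ideal (blowupRing S t)) (_ : 𝔫.IsPrime)
      (_ : (⟨t, le_blowupRing S t htS⟩ : blowupRing S t) ∈ 𝔫),
      (∀ h : I, ∀ z ∈ (LocalSubring.ofPrime (blowupRing S t) 𝔫).toSubring,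
        σ h z ∈ (LocalSubring.ofPrime (blowupRing S t) 𝔫).toSubring) ∧
      (∀ h : I, ∀ z ∈ (LocalSubring.ofPrime (blowupRing S t) 𝔫).toSubring,
        σ h z - z = 0 ∨ (σ h z - z)⁻¹ ∉ (LocalSubring.ofPrime (blowupRing S t) 𝔫).toSubring) ∧
      IsAlgClosed (ResidueField (LocalSubring.ofPrime (blowupRing S t) 𝔫).toSubring) ∧
      (∀ (h : I) (hσR : ∀ z ∈ (LocalSubring.ofPrime (blowupRing S t) 𝔫).toSubring,
          σ h z ∈ (LocalSubring.ofPrime (blowupRing S t) 𝔫).toSubring),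
        ∀ r ∈ Ideal.span {(⟨t, LocalSubring.le_ofPrime _ _ (le_blowupRing S t htS)⟩ :
          (LocalSubring.ofPrime (blowupRing S t) 𝔫).toSubring)},
        (⟨σ h r, hσR r r.2⟩ : (LocalSubring.ofPrime (blowupRing S t) 𝔫).toSubring) ∈
          Ideal.span {(⟨t, LocalSubring.le_ofPrime _ _ (le_blowupRing S t htS)⟩ :
            (LocalSubring.ofPrime (blowupRing S t) 𝔫).toSubring)}) := by
  classical
  -- the restricted action on `S` and its residue-triviality
  obtain ⟨τS, hτS⟩ := EigenlineChart.exists_restrict_ringAut S σ hσS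
  have hτS' : ∀ (h : I) (s : S), τS h s = ⟨σ h s, hσS h s s.2⟩ := fun h s => Subtype.ext (hτS h s)
  have hresS : ∀ (h : I) (s : S), τS h s - s ∈ maximalIdeal S := fun h s => by rw [hτS']; exact hres h s
  -- the stable tangent hyperplane `W` and an element `t₀ ∈ 𝔪 ∖ W`
  obtain ⟨W, hW2, hWle, hWne, hsup, hstabW⟩ := AbelianEigenline.exists_stable_tangentHyperplane τS hresS hS
  obtain ⟨t₀, ht₀m, ht₀W⟩ := SetLike.exists_of_lt (lt_of_le_of_ne hWle hWne)
  have hsup₀ := hsup t₀ ht₀m ht₀W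
  have ht₀2 : t₀ ∉ maximalIdeal S ^ 2 := fun h => ht₀W (hW2 h)
  have ht₀0 : (t₀ : K) ≠ 0 := by
    intro h
    have : t₀ = 0 := Subtype.ext h
    exact ht₀W (this ▸ W.zero_mem)
  -- adapted regular system of parameters
  obtain ⟨d, hd⟩ : ∃ d, (maximalIdeal S).spanFinrank = d := ⟨_, rfl⟩
  obtain ⟨x, i, hx, hxi, hxW, hWle'⟩ := EigenlineChart.exists_rsop_adapted_to_hyperplane hd W hW2 ht₀m ht₀W hsup₀
  have hxi0 : x i ≠ 0 := by rw [hxi]; exact fun h => ht₀0 (by rw [h]; rfl)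
  have hxm : ∀ j, x j ∈ maximalIdeal S := fun j => hx ▸ Ideal.subset_span ⟨j, rfl⟩
  -- hypotheses of the equivariant quadratic transform
  have hWσ : ∀ (h : I) (j : Fin d), j ≠ i → (⟨σ h ((x j : S) : K), hσS h _ (x j).2⟩ : S) ∈ W := by
    intro h j hj
    rw [← hτS']
    exact hstabW h (x j) (hxW j hj)
  have ht : ∀ h : I, ∃ u : S, IsUnit u ∧ (⟨σ h ((x i : S) : K), hσS h _ (x i).2⟩ : S) - u * x i ∈ W := by
    intro h
    obtain ⟨u, hu, huW⟩ := AbelianEigenline.exists_unit_mul_sub_mem_of_not_mem τS hresS W hW2 hstabW ht₀m ht₀W hsup₀ h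
    refine ⟨u, hu, ?_⟩
    rw [← hτS', hxi]
    exact huW
  obtain ⟨R₁, hqt, hxiinv, hfracs, hσR₁, hresR₁, hsame⟩ :=
    EigenlineChart.exists_equivariant_quadraticTransform S hd x hx i hxi0 hWle' (fun h => σ h) hσS hres hWσ ht
  haveI : IsLocalRing R₁ := hqt.isLocalRing
  have hSR₁ : S ≤ R₁ := hqt.dominates.1
  -- the chart `S[𝔪/x_i] ⊆ R₁` and the chart change `R₁ = S[𝔪/x_i]_𝔫`
  have hfrac' : ∀ j : Fin d, ((x j : S) : K) / ((x i : S) : K) ∈ R₁ := by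
    intro j
    by_cases hj : j = i
    · subst hj
      rw [div_self (fun h => hxi0 (Subtype.ext h))]
      exact R₁.one_mem
    · exact (hfracs j hj).1
  have hle : blowupRing S ((x i : S) : K) ≤ R₁ := by
    rw [blowupRing_eq_closure_of_span_eq ((x i : S) : K) (Set.range x) hx, Subring.closure_le]
    rintro z (hz | ⟨y, ⟨j, rfl⟩, rfl⟩)
    · exact hSR₁ hz
    · exact hfrac' j
  obtain ⟨𝔫, h𝔫, hR₁eq⟩ : ∃ (𝔫 : Ideal (blowupRing S ((x i : S) : K))) (_ : 𝔫.IsPrime),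
      R₁ = (LocalSubring.ofPrime (blowupRing S ((x i : S) : K)) 𝔫).toSubring :=
    ⟨_, inferInstance, hqt.eq_ofPrime (hxm i) hxi0 hle⟩
  -- `t := x i` lies in `𝔫`: it is a non-unit of `R₁`
  have htR₁m : (⟨((x i : S) : K), hSR₁ (x i).2⟩ : R₁) ∈ maximalIdeal R₁ :=
    (mem_maximalIdeal_iff_inv_not_mem _).mpr (Or.inr hxiinv)
  -- residue field of `R₁`
  have hdomle : LocalSubring.mk S ≤ LocalSubring.mk R₁ := (subringDominates_iff S R₁).mp hqt.dominates
  obtain ⟨hle', hloc⟩ := LocalSubring.le_def.mp hdomle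
  haveI : IsLocalHom (Subring.inclusion hSR₁) := hloc
  have hκ : IsAlgClosed (ResidueField R₁) :=
    isAlgClosed_residueField_of_residue_surjective (Subring.inclusion hSR₁) fun z => by
      obtain ⟨s, hs, hzs⟩ := hsame z z.2
      refine ⟨⟨s, hs⟩, (mem_maximalIdeal_iff_inv_not_mem _).mpr ?_⟩
      exact hzs
  -- `(t) R₁` is stable
  have hstab : ∀ (h : I) (hσR : ∀ z ∈ R₁, σ h z ∈ R₁), ∀ r ∈ Ideal.span {(⟨((x i : S) : K), hSR₁ (x i).2⟩ : R₁)},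
      (⟨σ h r, hσR r r.2⟩ : R₁) ∈ Ideal.span {(⟨((x i : S) : K), hSR₁ (x i).2⟩ : R₁)} :=
    fun h hσR => span_singleton_stable hSR₁ (σ h) (hσS h) hσR (hres h) x hx i hfrac'
      (fun e => hxi0 (Subtype.ext e))
  -- transport everything along `R₁ = S[𝔪/x_i]_𝔫`
  subst hR₁eq
  refine ⟨((x i : S) : K), (x i).2, hxm i, ?_, fun e => hxi0 (Subtype.ext e), 𝔫, h𝔫, ?_, hσR₁, hresR₁, hκ,
    hstab⟩
  · exact hxi ▸ ht₀2
  · exact (IsLocalization.AtPrime.to_map_mem_maximal_iff _ 𝔫 _).mp htR₁m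

end Summit.ResolutionOfSingularities.ResolutionOfSingularities.Theorems.WildQuotientResolution.KSGoingDown

end
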